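import Summits.Ventures.PercRepro.S1Basics

/-!
# PercRepro — S1 PLANE COUNTS: the rank-`4` five-sets of a rank-`4` flat (p4, gen 14; SUBCLAIM-S1 §4, (A4))

`proofs/SUBCLAIM-S1-p2.md` §4 PROPOSITION A, step (A4), typed per `proofs/S1-LEAN-SPEC-p2.md` L1. Throughout, `M`
is a finite matroid with «lines have `≤ 3` points» (`hline`) and «planes have `≤ 6` points» (`hplane`), and `F` is a
rank-`4` flat (`M.closure F = F`, `M.eRk F = 4`); `rank4Five M F` are its five-subsets of rank `4`.

* `choose_five_eq_ncard_rank4Five_add` — `C(|F|, 5) = #rank4Five + #low5` (the five-subsets split by rank);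
* `exists_planes` — the low five-sets are five-subsets of finitely many planes `P ⊆ F` (rank `3`, closed,
  `5 ≤ |P| ≤ 6`) pairwise sharing `≤ 3` points (`ncard_inter_le_three_of_planes`);
* **`five_mul_choose_le_ncard_rank4Five`** (A4) — `5·C(|F|, 5) ≤ 5·#rank4Five + 2·C(|F|, 4)`: distinct planes have
  disjoint families of four-subsets of `F`, and `5·C(|P|, 5) ≤ 2·C(|P|, 4)` for `|P| ≤ 6`;
* `one_le_ncard_rank4Five_of_five`, `five_le_ncard_rank4Five_of_six`, `fifteen_le_ncard_rank4Five_of_seven` —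
  the lower bounds `μ(5) = 1`, `μ(6) = 5`, `μ(7) = 15`.
Axioms: standard.
-/

open scoped Matroid

namespace PercRepro

namespace S1

open Set

variable {α : Type}

/-- `5·C(m, 5) ≤ 2·C(m, 4)` for `m ≤ 6`. -/
theorem five_mul_choose_five_le (m : ℕ) (hm : m ≤ 6) : 5 * m.choose 5 ≤ 2 * m.choose 4 := by
  interval_cases m <;> decide

/-- The five-element subsets of a finite set `F`, as a finset of sets; it has `C(|F|, 5)` members. -/
theorem mem_image_powersetCard_iff {F : Set α} (hFfin : F.Finite) (j : ℕ) (Q : Set α) :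
    Q ∈ (hFfin.toFinset.powersetCard j).image (fun s : Finset α => (s : Set α)) ↔ Q ⊆ F ∧ Q.ncard = j := by
  rw [Finset.mem_image]
  constructor
  · rintro ⟨s, hs, rfl⟩
    rw [Finset.mem_powersetCard] at hs
    refine ⟨?_, by rw [Set.ncard_coe_finset]; exact hs.2⟩
    intro x hx
    have := hs.1 (Finset.mem_coe.1 hx)
    rwa [Set.Finite.mem_toFinset] at this
  · rintro ⟨hQF, hQj⟩
    have hQfin : Q.Finite := hFfin.subset hQF
    refine ⟨hQfin.toFinset, ?_, by simp⟩
    rw [Finset.mem_powersetCard]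
    refine ⟨?_, by rw [← Set.ncard_eq_toFinset_card Q hQfin]; exact hQj⟩
    intro x hx
    rw [Set.Finite.mem_toFinset] at hx
    rw [Set.Finite.mem_toFinset]
    exact hQF hx

/-- The number of `j`-element subsets of a finite set `F` (as a finset of sets) is `C(|F|, j)`. -/
theorem card_image_powersetCard {F : Set α} (hFfin : F.Finite) (j : ℕ) :
    ((hFfin.toFinset.powersetCard j).image (fun s : Finset α => (s : Set α))).card = F.ncard.choose j := by
  rw [Finset.card_image_of_injective _ Finset.coe_injective, Finset.card_powersetCard,
    ← Set.ncard_eq_toFinset_card _ hFfin]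

/-- The five-element subsets of `F` of rank `≤ 3` (the «low» five-sets). -/
def low5 (M : Matroid α) (F : Set α) : Set (Set α) :=
  {Q : Set α | Q ⊆ F ∧ Q.ncard = 5 ∧ M.eRk Q ≤ 3}

/-- `rank4Five M F` is finite. -/
theorem rank4Five_finite (M : Matroid α) {F : Set α} (hFfin : F.Finite) : (rank4Five M F).Finite :=
  hFfin.finite_subsets.subset (fun _ hQ => hQ.1)

/-- **The five-subsets of a rank-`4` flat split by rank**: `C(|F|, 5) = #rank4Five + #low5`. -/
theorem choose_five_eq_ncard_rank4Five_add (M : Matroid α) [M.Finite] {F : Set α} (hF : F ⊆ M.E)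
    (hr : M.eRk F = 4) : F.ncard.choose 5 = (rank4Five M F).ncard + (low5 M F).ncard := by
  classical
  have hFfin : F.Finite := M.ground_finite.subset hF
  set fives : Finset (Set α) := (hFfin.toFinset.powersetCard 5).image (fun s : Finset α => (s : Set α))
    with hfives
  have hfives_card : fives.card = F.ncard.choose 5 := card_image_powersetCard hFfin 5
  have hmem_fives : ∀ Q, Q ∈ fives ↔ Q ⊆ F ∧ Q.ncard = 5 := fun Q => mem_image_powersetCard_iff hFfin 5 Q
  set R := fives.filter (fun Q => M.eRk Q = 4) with hR
  set L := fives.filter (fun Q => ¬ M.eRk Q = 4) with hL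
  have hsplit : R.card + L.card = fives.card := Finset.card_filter_add_card_filter_not _
  have hRcard : R.card = (rank4Five M F).ncard := by
    have : (R : Set (Set α)) = rank4Five M F := by
      ext Q
      rw [Finset.mem_coe, hR, Finset.mem_filter, hmem_fives]
      simp only [rank4Five, Set.mem_setOf_eq]
      tauto
    rw [← this, Set.ncard_coe_finset]
  have hLcard : L.card = (low5 M F).ncard := by
    have : (L : Set (Set α)) = low5 M F := by
      ext Q
      rw [Finset.mem_coe, hL, Finset.mem_filter, hmem_fives]
      simp only [low5, Set.mem_setOf_eq]
      constructor
      · rintro ⟨⟨hQF, hQ5⟩, hne⟩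
        refine ⟨hQF, hQ5, ?_⟩
        have h4 : M.eRk Q ≤ 4 := by rw [← hr]; exact M.eRk_mono hQF
        have hlt : M.eRk Q < (3 : ℕ∞) + 1 := by
          rw [show ((3 : ℕ∞) + 1) = 4 by norm_num]; exact lt_of_le_of_ne h4 hne
        simpa using Order.le_of_lt_add_one hlt
      · rintro ⟨hQF, hQ5, hle⟩
        refine ⟨⟨hQF, hQ5⟩, fun h => ?_⟩
        rw [h] at hle
        exact absurd hle (by norm_num)
    rw [← this, Set.ncard_coe_finset]
  rw [← hfives_card, ← hsplit, hRcard, hLcard]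

/-- **Two distinct planes share at most `3` points**: if `P ≠ P'` are closures of rank `3` inside `E`, then
`|P ∩ P'| ≤ 3` (under «lines have `≤ 3` points»). -/
theorem ncard_inter_le_three_of_planes (M : Matroid α) [M.Finite]
    (hline : ∀ L ⊆ M.E, M.eRk L ≤ 2 → L.ncard ≤ 3) {P P' : Set α} (hP : P ⊆ M.E) (hrP : M.eRk P = 3)
    (hclP : M.closure P = P) (hrP' : M.eRk P' = 3) (hclP' : M.closure P' = P')
    (hne : P ≠ P') : (P ∩ P').ncard ≤ 3 := by
  by_contra h4
  push Not at h4
  have hfin : (P ∩ P').Finite := M.ground_finite.subset (inter_subset_left.trans hP)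
  have h3 : (3 : ℕ∞) ≤ M.eRk (P ∩ P') :=
    three_le_eRk_of_four_le_ncard M hline (inter_subset_left.trans hP) (by omega)
  have h1 : M.closure (P ∩ P') = M.closure P :=
    closure_eq_closure_of_subset_of_eRk_le M hfin inter_subset_left (by rw [hrP]; exact h3)
  have h2 : M.closure (P ∩ P') = M.closure P' :=
    closure_eq_closure_of_subset_of_eRk_le M hfin inter_subset_right (by rw [hrP']; exact h3)
  exact hne (by rw [← hclP, ← h1, h2, hclP'])

/-- **THE PLANES OF A RANK-`4` FLAT**: the low five-sets of `F` are five-subsets of finitely many planes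
`P ⊆ F` (rank `3`, closed, `5 ≤ |P| ≤ 6`), pairwise sharing at most `3` points. -/
theorem exists_planes (M : Matroid α) [M.Finite]
    (hline : ∀ L ⊆ M.E, M.eRk L ≤ 2 → L.ncard ≤ 3) (hplane : ∀ P ⊆ M.E, M.eRk P ≤ 3 → P.ncard ≤ 6)
    {F : Set α} (hF : F ⊆ M.E) (hcl : M.closure F = F) :
    ∃ PL : Finset (Set α),
      (∀ P ∈ PL, P ⊆ F ∧ M.eRk P = 3 ∧ M.closure P = P ∧ 5 ≤ P.ncard ∧ P.ncard ≤ 6) ∧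
      (∀ P ∈ PL, ∀ P' ∈ PL, P ≠ P' → (P ∩ P').ncard ≤ 3) ∧
      (low5 M F).ncard ≤ ∑ P ∈ PL, P.ncard.choose 5 := by
  classical
  have hFfin : F.Finite := M.ground_finite.subset hF
  have hLfin : (low5 M F).Finite := hFfin.finite_subsets.subset (fun _ hQ => hQ.1)
  set L := hLfin.toFinset with hL
  have hmemL : ∀ Q, Q ∈ L ↔ Q ⊆ F ∧ Q.ncard = 5 ∧ M.eRk Q ≤ 3 := by
    intro Q; rw [hL, Set.Finite.mem_toFinset]; rfl
  set PL := L.image M.closure with hPL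
  have hplaneP : ∀ P ∈ PL, P ⊆ F ∧ M.eRk P = 3 ∧ M.closure P = P ∧ 5 ≤ P.ncard ∧ P.ncard ≤ 6 := by
    intro P hP
    rw [hPL, Finset.mem_image] at hP
    obtain ⟨Q, hQ, rfl⟩ := hP
    obtain ⟨hQF, hQ5, hrQ⟩ := (hmemL Q).1 hQ
    obtain ⟨-, hsub, hrcl, hcard, hQcl⟩ := plane_of_five_low M hline hplane hF hcl hQF hQ5 hrQ
    refine ⟨hsub, hrcl, M.closure_closure Q, ?_, hcard⟩
    rw [← hQ5]
    exact Set.ncard_le_ncard hQcl (hFfin.subset hsub)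
  refine ⟨PL, hplaneP, ?_, ?_⟩
  · intro P hP P' hP' hne
    obtain ⟨hPF, hrP, hclP, -, -⟩ := hplaneP P hP
    obtain ⟨-, hrP', hclP', -, -⟩ := hplaneP P' hP'
    exact ncard_inter_le_three_of_planes M hline (hPF.trans hF) hrP hclP hrP' hclP' hne
  · rw [Set.ncard_eq_toFinset_card _ hLfin, ← hL]
    rw [Finset.card_eq_sum_card_fiberwise (f := M.closure) (t := PL)
      (fun Q hQ => Finset.mem_image_of_mem _ hQ)]
    apply Finset.sum_le_sum
    intro P hP
    obtain ⟨hPF, -, -, -, -⟩ := hplaneP P hP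
    have hPfin : P.Finite := hFfin.subset hPF
    rw [← card_image_powersetCard hPfin 5]
    apply Finset.card_le_card
    intro Q hQ
    rw [Finset.mem_filter] at hQ
    obtain ⟨hQF, hQ5, -⟩ := (hmemL Q).1 hQ.1
    rw [mem_image_powersetCard_iff hPfin 5]
    refine ⟨?_, hQ5⟩
    rw [← hQ.2]; exact M.subset_closure Q (hQF.trans hF)

/-- **(A4) THE `μ` INEQUALITY**: for a rank-`4` flat `F`, `5·C(|F|, 5) ≤ 5·#rank4Five(F) + 2·C(|F|, 4)`. The
five-subsets of `F` of rank `≤ 3` are five-subsets of the planes `P ⊆ F` (each of `≤ 6` points), distinct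
planes carry disjoint families of four-subsets of `F`, and `5·C(|P|, 5) ≤ 2·C(|P|, 4)` for `|P| ≤ 6`. -/
theorem five_mul_choose_le_ncard_rank4Five (M : Matroid α) [M.Finite]
    (hline : ∀ L ⊆ M.E, M.eRk L ≤ 2 → L.ncard ≤ 3) (hplane : ∀ P ⊆ M.E, M.eRk P ≤ 3 → P.ncard ≤ 6)
    {F : Set α} (hF : F ⊆ M.E) (hcl : M.closure F = F) (hr : M.eRk F = 4) :
    5 * F.ncard.choose 5 ≤ 5 * (rank4Five M F).ncard + 2 * F.ncard.choose 4 := by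
  classical
  have hFfin : F.Finite := M.ground_finite.subset hF
  obtain ⟨PL, hplaneP, hinter, hlow⟩ := exists_planes M hline hplane hF hcl
  -- `5·C(|P|, 5) ≤ 2·C(|P|, 4)` on every plane
  have hnum : 5 * ∑ P ∈ PL, P.ncard.choose 5 ≤ 2 * ∑ P ∈ PL, P.ncard.choose 4 := by
    rw [Finset.mul_sum, Finset.mul_sum]
    apply Finset.sum_le_sum
    intro P hP
    exact five_mul_choose_five_le _ (hplaneP P hP).2.2.2.2
  -- the four-subsets of the planes: disjoint families inside the four-subsets of `F`
  set fours : Set α → Finset (Set α) := fun P =>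
    ((hFfin.toFinset.filter (fun x => x ∈ P)).powersetCard 4).image (fun s : Finset α => (s : Set α))
    with hfours
  have hPf : ∀ P, (hP : P ∈ PL) →
      (hFfin.toFinset.filter (fun x => x ∈ P)) = (hFfin.subset (hplaneP P hP).1).toFinset := by
    intro P hP
    ext x
    rw [Finset.mem_filter, Set.Finite.mem_toFinset, Set.Finite.mem_toFinset]
    exact ⟨fun h => h.2, fun h => ⟨(hplaneP P hP).1 h, h⟩⟩
  have hfours_mem : ∀ P ∈ PL, ∀ T, T ∈ fours P ↔ T ⊆ P ∧ T.ncard = 4 := by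
    intro P hP T
    rw [hfours]
    simp only
    rw [hPf P hP]
    exact mem_image_powersetCard_iff _ 4 T
  have hfours_card : ∀ P ∈ PL, (fours P).card = P.ncard.choose 4 := by
    intro P hP
    rw [hfours]
    simp only
    rw [hPf P hP]
    exact card_image_powersetCard _ 4
  have hdisj : (PL : Set (Set α)).PairwiseDisjoint fours := by
    intro P hP P' hP' hne
    rw [Function.onFun, Finset.disjoint_left]
    intro T hT hT'
    rw [hfours_mem P hP] at hT
    rw [hfours_mem P' hP'] at hT'
    have h := hinter P hP P' hP' hne
    have hTfin : T.Finite := hFfin.subset (hT.1.trans (hplaneP P hP).1)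
    have : T.ncard ≤ (P ∩ P').ncard :=
      Set.ncard_le_ncard (subset_inter hT.1 hT'.1) (hFfin.subset (inter_subset_left.trans (hplaneP P hP).1))
    omega
  have hunion : PL.biUnion fours ⊆ (hFfin.toFinset.powersetCard 4).image (fun s : Finset α => (s : Set α)) := by
    intro T hT
    rw [Finset.mem_biUnion] at hT
    obtain ⟨P, hP, hTP⟩ := hT
    rw [hfours_mem P hP] at hTP
    rw [mem_image_powersetCard_iff hFfin 4]
    exact ⟨hTP.1.trans (hplaneP P hP).1, hTP.2⟩
  have hfour : ∑ P ∈ PL, P.ncard.choose 4 ≤ F.ncard.choose 4 := by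
    calc ∑ P ∈ PL, P.ncard.choose 4 = ∑ P ∈ PL, (fours P).card :=
          Finset.sum_congr rfl (fun P hP => (hfours_card P hP).symm)
      _ = (PL.biUnion fours).card := (Finset.card_biUnion hdisj).symm
      _ ≤ ((hFfin.toFinset.powersetCard 4).image (fun s : Finset α => (s : Set α))).card :=
          Finset.card_le_card hunion
      _ = F.ncard.choose 4 := card_image_powersetCard hFfin 4
  -- assemble
  rw [choose_five_eq_ncard_rank4Five_add M hF hr]
  omega

/-- `μ(5) = 1`: a five-point rank-`4` flat is itself a rank-`4` five-set. -/
theorem one_le_ncard_rank4Five_of_five (M : Matroid α) [M.Finite] {F : Set α} (hF : F ⊆ M.E)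
    (hr : M.eRk F = 4) (h5 : F.ncard = 5) : 1 ≤ (rank4Five M F).ncard := by
  have hFfin : F.Finite := M.ground_finite.subset hF
  have hmem : F ∈ rank4Five M F := ⟨subset_rfl, h5, hr⟩
  have := (Set.ncard_pos (rank4Five_finite M hFfin)).2 ⟨F, hmem⟩
  omega

/-- Two distinct planes of a rank-`4` flat (each with `≥ 5` points, sharing `≤ 3`) together have at least
`7` points. -/
theorem seven_le_ncard_union_of_planes {F P P' : Set α} (hFfin : F.Finite) (hP : P ⊆ F) (hP' : P' ⊆ F)
    (h5 : 5 ≤ P.ncard) (h5' : 5 ≤ P'.ncard) (hinter : (P ∩ P').ncard ≤ 3) : 7 ≤ (P ∪ P').ncard := by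
  have := Set.ncard_union_add_ncard_inter P P' (hFfin.subset hP) (hFfin.subset hP')
  omega

/-- `μ(6) = 5`: a six-point rank-`4` flat has at least `5` rank-`4` five-sets (at most one of its six
five-subsets is a plane). -/
theorem five_le_ncard_rank4Five_of_six (M : Matroid α) [M.Finite]
    (hline : ∀ L ⊆ M.E, M.eRk L ≤ 2 → L.ncard ≤ 3) (hplane : ∀ P ⊆ M.E, M.eRk P ≤ 3 → P.ncard ≤ 6)
    {F : Set α} (hF : F ⊆ M.E) (hcl : M.closure F = F) (hr : M.eRk F = 4) (h6 : F.ncard = 6) :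
    5 ≤ (rank4Five M F).ncard := by
  classical
  have hFfin : F.Finite := M.ground_finite.subset hF
  obtain ⟨PL, hplaneP, hinter, hlow⟩ := exists_planes M hline hplane hF hcl
  have hsplit := choose_five_eq_ncard_rank4Five_add M hF hr
  rw [h6] at hsplit
  -- every plane has exactly `5` points (it is a proper subset of `F`)
  have hP5 : ∀ P ∈ PL, P.ncard = 5 := by
    intro P hP
    obtain ⟨hPF, hrP, -, h5, -⟩ := hplaneP P hP
    have hne : P ≠ F := fun h => by rw [h, hr] at hrP; exact absurd hrP (by norm_num)
    have hlt : P.ncard < F.ncard := Set.ncard_lt_ncard (LE.le.ssubset_of_ne hPF hne) hFfin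
    omega
  -- at most one plane
  have hcard : PL.card ≤ 1 := by
    rw [Finset.card_le_one]
    intro P hP P' hP'
    by_contra hne
    have h7 := seven_le_ncard_union_of_planes hFfin (hplaneP P hP).1 (hplaneP P' hP').1
      (hplaneP P hP).2.2.2.1 (hplaneP P' hP').2.2.2.1 (hinter P hP P' hP' hne)
    have : (P ∪ P').ncard ≤ F.ncard :=
      Set.ncard_le_ncard (union_subset (hplaneP P hP).1 (hplaneP P' hP').1) hFfin
    omega
  have hsum : ∑ P ∈ PL, P.ncard.choose 5 ≤ 1 := by
    calc ∑ P ∈ PL, P.ncard.choose 5 = ∑ P ∈ PL, 1 := by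
          apply Finset.sum_congr rfl
          intro P hP
          rw [hP5 P hP, Nat.choose_self]
      _ = PL.card := by rw [Finset.sum_const, smul_eq_mul, mul_one]
      _ ≤ 1 := hcard
  have : Nat.choose 6 5 = 6 := by decide
  omega

/-- `μ(7) = 15`: a seven-point rank-`4` flat has at least `15` rank-`4` five-sets (a six-point plane excludes
every other plane; five-point planes have pairwise disjoint two-point complements, so there are at most three). -/
theorem fifteen_le_ncard_rank4Five_of_seven (M : Matroid α) [M.Finite]
    (hline : ∀ L ⊆ M.E, M.eRk L ≤ 2 → L.ncard ≤ 3) (hplane : ∀ P ⊆ M.E, M.eRk P ≤ 3 → P.ncard ≤ 6)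
    {F : Set α} (hF : F ⊆ M.E) (hcl : M.closure F = F) (hr : M.eRk F = 4) (h7 : F.ncard = 7) :
    15 ≤ (rank4Five M F).ncard := by
  classical
  have hFfin : F.Finite := M.ground_finite.subset hF
  obtain ⟨PL, hplaneP, hinter, hlow⟩ := exists_planes M hline hplane hF hcl
  have hsplit := choose_five_eq_ncard_rank4Five_add M hF hr
  rw [h7] at hsplit
  have h21 : Nat.choose 7 5 = 21 := by decide
  -- two distinct planes cover `F`: their complements in `F` are disjoint
  have hcover : ∀ P ∈ PL, ∀ P' ∈ PL, P ≠ P' → P ∪ P' = F := by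
    intro P hP P' hP' hne
    have h7' := seven_le_ncard_union_of_planes hFfin (hplaneP P hP).1 (hplaneP P' hP').1
      (hplaneP P hP).2.2.2.1 (hplaneP P' hP').2.2.2.1 (hinter P hP P' hP' hne)
    exact Set.eq_of_subset_of_ncard_le (union_subset (hplaneP P hP).1 (hplaneP P' hP').1) (by omega) hFfin
  suffices hsum : ∑ P ∈ PL, P.ncard.choose 5 ≤ 6 by omega
  by_cases hsix : ∃ P ∈ PL, P.ncard = 6
  · -- a six-point plane is the only plane
    obtain ⟨P, hP, hP6⟩ := hsix
    have hPL : PL = {P} := by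
      apply Finset.eq_singleton_iff_unique_mem.2 ⟨hP, ?_⟩
      intro P' hP'
      by_contra hne
      have hne' : P ≠ P' := fun h => hne h.symm
      have hu := hcover P hP P' hP' hne'
      have := Set.ncard_union_add_ncard_inter P P' (hFfin.subset (hplaneP P hP).1)
        (hFfin.subset (hplaneP P' hP').1)
      have := hinter P hP P' hP' hne'
      have := (hplaneP P' hP').2.2.2.1
      rw [hu, h7] at *
      omega
    rw [hPL, Finset.sum_singleton, hP6]
    decide
  · -- every plane has five points; their two-point complements are pairwise disjoint in `F`
    push Not at hsix
    have hP5 : ∀ P ∈ PL, P.ncard = 5 := by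
      intro P hP
      have := (hplaneP P hP).2.2.2.1
      have := (hplaneP P hP).2.2.2.2
      have := hsix P hP
      omega
    set comp : Set α → Finset α := fun P => hFfin.toFinset.filter (fun x => x ∉ P) with hcomp
    have hcomp_card : ∀ P ∈ PL, (comp P).card = 2 := by
      intro P hP
      have hcoe : ((comp P : Finset α) : Set α) = F \ P := by
        ext x
        rw [hcomp]
        simp only [Finset.coe_filter, Set.Finite.mem_toFinset, Set.mem_setOf_eq, Set.mem_sdiff]
      rw [← Set.ncard_coe_finset, hcoe, Set.ncard_sdiff' (hplaneP P hP).1 hFfin, h7, hP5 P hP]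
    have hdisj : (PL : Set (Set α)).PairwiseDisjoint comp := by
      intro P hP P' hP' hne
      rw [Function.onFun, Finset.disjoint_left]
      intro x hx hx'
      rw [hcomp] at hx hx'
      simp only [Finset.mem_filter, Set.Finite.mem_toFinset] at hx hx'
      have hu := hcover P hP P' hP' hne
      have : x ∈ P ∪ P' := by rw [hu]; exact hx.1
      rcases this with h | h
      · exact hx.2 h
      · exact hx'.2 h
    have hunion : PL.biUnion comp ⊆ hFfin.toFinset := by
      intro x hx
      rw [Finset.mem_biUnion] at hx
      obtain ⟨P, -, hxP⟩ := hx
      rw [hcomp] at hxP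
      exact (Finset.mem_filter.1 hxP).1
    have hcount : 2 * PL.card ≤ 7 := by
      calc 2 * PL.card = ∑ P ∈ PL, (comp P).card := by
            rw [Finset.sum_congr rfl hcomp_card, Finset.sum_const, smul_eq_mul, mul_comm]
        _ = (PL.biUnion comp).card := (Finset.card_biUnion hdisj).symm
        _ ≤ hFfin.toFinset.card := Finset.card_le_card hunion
        _ = 7 := by rw [← Set.ncard_eq_toFinset_card _ hFfin, h7]
    calc ∑ P ∈ PL, P.ncard.choose 5 = ∑ P ∈ PL, 1 := by
          apply Finset.sum_congr rfl
          intro P hP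
          rw [hP5 P hP, Nat.choose_self]
      _ = PL.card := by rw [Finset.sum_const, smul_eq_mul, mul_one]
      _ ≤ 6 := by omega

end S1

end PercRepro
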